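import Summits.QuantumFields.BalabanUV.Beta.GAN24.MonotoneShorted
import Literature.MathematicalPhysics.QuantumFieldTheory.Balaban1983to89.B5Prop11Lower

/-!
# Beta / GAN24 / MonotoneSqueeze — THE TRIAL-SUBSPACE SQUEEZE for shorted (effective) forms of DEGENERATE quadratic forms: a prolongation `P`
# that does not raise the energy turns road P4's monotone chain `E_c ≤ E_f` into a two-sided bound `0 ≤ E_f − E_c ≤ −(E_f·R + Rᴴ·E_f)`, `R` the
# ROW DEFECT `C_f·P·harmExt_c − 1` of the prolongated coarse minimiser, and bounds the ENERGY DISTANCE between that trial field and the fine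
# minimiser by the same form — the assembly steps S5 + S6(i) of candidate route R1 of `HOME/beta/ROUTES-GAN24.md` v1 in the kernel, modulo its
# two concrete inputs (PROL) and the size of `R` (binder row G-an2-4 ∕ (CONV-C); road P2 seat gan24-p2 gen 28; NOT IN PRINT — our proof attempt)

HONEST FRAMING (page 1 of everything the β sub-cell writes): discharging `BetaPertH` makes Bałaban's UV stability UNCONDITIONAL — a
real constructive-QFT result; it is NOT the continuum limit and NOT the Clay problem.  HONEST DEPENDENCY (cell reorg 2026-08-19, verbatim):
«continuum YM on T⁴ ⇐ BetaPertH ∧ nine spine estimates (0/9 proved); BetaPertH ⇐ (D1) ∧ (D4) ∧ CAP+tail; G-an2-4 gates asym, D1 and NE2/3/4.»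
HONEST LABEL: «not in print; our proof attempt»; 0 wall binders instantiated; NEVER «G-an2-4 closed».

ABSOLUTE RULE (cell charter, verbatim): "No internally-minted statement may enter as a cited fact. Every hypothesis is either
kernel-proved in this package or a verbatim quotation of a PUBLISHED theorem with page reference. The manuscript(s) under audit are
NOT citable for their own disputed steps — they are the thing under adjudication; programme-internal (2001/route/tribunal) claims
are never citable."  Nothing is cited; [folklore] finite-dimensional linear algebra over road P4's `MonotoneShorted` (`harmExt`, `shortForm`,
`H_mul_harmExt`, `quad_harmExt_add`, `shortForm_quad_le`) BY NAME; the hypotheses (PROL) and (MONO) are PSD ∕ real inequalities about the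
parameters, no `def … : Prop` is asserted of anything.

## THE MECHANISM (ROUTES-GAN24 v1, R1 «monotone + trial-subspace squeeze», steps S5–S6; idea-1)
Fine and coarse degenerate PSD forms `H_f`, `H_c`, read by surjective averagings `C_f`, `C_c` (sections `S_f`, `S_c`) onto ONE coarse space `κ`; their
shorted forms `E_f = shortForm H_f C_f S_f`, `E_c = shortForm H_c C_c S_c` (`⟨B,E B⟩ = min{⟨A,HA⟩ : C A = B}`) and minimisers `h_f = harmExt H_f C_f S_f`,
`h_c`.  A PROLONGATION `P : ι_c → ι_f` with **(PROL)** `re⟨Pu, H_f Pu⟩ ≤ re⟨u, H_c u⟩` (R1-S2: «prolongation does not raise the energy») gives the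
admissible COMPETITOR `w(B) := P h_c B − h_f (R B)`, `R := C_f·P·h_c − 1` (the row defect, R1-S3), `C_f w(B) = B`; the minimum property of `E_f`
and the outer Euler–Lagrange identity `H_f·h_f = C_fᴴ·E_f` give the exact bookkeeping
  `re⟨B, E_f B⟩ ≤ re⟨w, H_f w⟩ = re⟨Ph_cB, H_f Ph_cB⟩ − 2re⟨B, E_f(RB)⟩ − re⟨RB, E_f(RB)⟩ ≤ re⟨B, E_c B⟩ − 2re⟨B, E_f(RB)⟩ − re⟨RB, E_f(RB)⟩`,
and Pythagoras on the fibre gives the ENERGY DISTANCE `re⟨w − h_fB, H_f(w − h_fB)⟩ = re⟨w,H_fw⟩ − re⟨B,E_fB⟩`.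

## WHAT IS PROVED (0 sorry; over `ℂ`)
* §1 `rowDefect`, `trial`, `Cf_trial_mulVec` (admissibility), `trial_quad_re` (the exact bookkeeping above).
* §2 **`shortForm_quad_le_trial`** (`re⟨B,E_fB⟩ ≤ re⟨B,E_cB⟩ − 2re⟨B,E_f(RB)⟩ − re⟨RB,E_f(RB)⟩` under (PROL)), **`squeeze`** (with (MONO) `E_c ≤ E_f`:
  `0 ≤ re⟨B,(E_f − E_c)B⟩ ≤ −2re⟨B,E_f(RB)⟩`), **`energy_dist_trial_le`** (`re⟨w − h_fB, H_f(w − h_fB)⟩ ≤ −2re⟨B,E_f(RB)⟩ − re⟨RB,E_f(RB)⟩` under (PROL)+(MONO)).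
* §3 norm form: **`squeeze_nsq`** — if `‖E_f‖ ≤ Λ` and `nsq (RB) ≤ ρ²·nsq B` then `re⟨B,(E_f − E_c)B⟩ ≤ 2Λρ·nsq B` and
  `re⟨w − h_fB, H_f(w − h_fB)⟩ ≤ 2Λρ·nsq B` (Cauchy–Schwarz) — so a row defect `ρ = O(η²)` IS the `η²` rate of R1, and the trial field is within
  `O(η)·‖B‖` of the fine minimiser in ENERGY norm (S6(i)).
INSTANTIATION (not done here): road P4's `MonotoneTorusEffective.effAction k = shortForm (hform k) (sread k) (Jlift …)` at two levels `j ≤ K` with the cubical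
cochain prolongation of `SmoothRefineWhitney`∕`CellTaylorPlanting` type; (MONO) = `effAction_step_mono`; (PROL) and `ρ = O(Lc^{−2j})` are R1's open concrete
inputs S2, S3+S4 — both CONFIRMED NUMERICALLY for 1-forms with Bałaban's line-sum rows ((P-R1c), kit j121501, memo `HOME/b2b-balaban-gan24-p2/gen28/ROUTE-AUDIT-P2.md` §2).
NOT (CONV-C), NOT D1, NOT BetaPertH, NOT continuum, NOT Clay.
-/

noncomputable section

namespace Summit.QuantumFields.BalabanUV.Beta.GAN24.MonotoneSqueeze

open Matrix
open scoped ComplexOrder Matrix.Norms.L2Operator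
open Literature.MathematicalPhysics.QuantumFieldTheory.Balaban1983to89.B5Prop11Lower (nsq nsq_nonneg norm_star_dotProduct_le nsq_mulVec_le)
open Summit.QuantumFields.BalabanUV.Beta.GAN24.MonotoneCoarsen (conj_pairing)
open Summit.QuantumFields.BalabanUV.Beta.GAN24.MonotoneShorted (harmExt shortForm C_harmExt_mulVec H_harmExt_mulVec quad_harmExt_add shortForm_quad
  shortForm_quad_le shortForm_isHermitian shortForm_posSemidef)

variable {ι₀ ι₁ κ : Type*} [Fintype ι₀] [DecidableEq ι₀] [Fintype ι₁] [DecidableEq ι₁] [Fintype κ] [DecidableEq κ]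
variable {Hc : Matrix ι₀ ι₀ ℂ} {Hf : Matrix ι₁ ι₁ ℂ}

/-! ## §1 The row defect, the trial field, and the exact bookkeeping -/

/-- **THE ROW DEFECT** of the prolongated coarse minimiser: `R := C_f·P·harmExt_c − 1` (R1-S3: «constraint consistency up to centring»). [folklore] -/
def rowDefect (hHc : Hc.IsHermitian) (Cc : Matrix κ ι₀ ℂ) (Sc : Matrix ι₀ κ ℂ) (Cf : Matrix κ ι₁ ℂ) (P : Matrix ι₁ ι₀ ℂ) : Matrix κ κ ℂ :=
  Cf * P * harmExt hHc Cc Sc - 1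

/-- **THE TRIAL FIELD** `w := P·harmExt_c − harmExt_f·R`: the prolongated coarse minimiser with the exact fine correction of its row defect. [folklore] -/
def trial (hHc : Hc.IsHermitian) (hHf : Hf.IsHermitian) (Cc : Matrix κ ι₀ ℂ) (Sc : Matrix ι₀ κ ℂ) (Cf : Matrix κ ι₁ ℂ) (Sf : Matrix ι₁ κ ℂ)
    (P : Matrix ι₁ ι₀ ℂ) : Matrix ι₁ κ ℂ :=
  P * harmExt hHc Cc Sc - harmExt hHf Cf Sf * rowDefect hHc Cc Sc Cf P

omit [DecidableEq ι₁] in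
/-- `C_f (P h_c B) = B + R B`. [folklore] -/
theorem Cf_P_harmExt_mulVec (hHc : Hc.IsHermitian) (Cc : Matrix κ ι₀ ℂ) (Sc : Matrix ι₀ κ ℂ) (Cf : Matrix κ ι₁ ℂ) (P : Matrix ι₁ ι₀ ℂ) (B : κ → ℂ) :
    Cf *ᵥ (P *ᵥ (harmExt hHc Cc Sc *ᵥ B)) = B + rowDefect hHc Cc Sc Cf P *ᵥ B := by
  rw [rowDefect, sub_mulVec, one_mulVec, ← mulVec_mulVec, ← mulVec_mulVec]; abel

/-- **ADMISSIBILITY**: `C_f (w B) = B` — the trial field lies in the fibre of `B` (`C_f S_f = 1`). [folklore] -/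
theorem Cf_trial_mulVec (hHc : Hc.IsHermitian) (hHf : Hf.IsHermitian) (Cc : Matrix κ ι₀ ℂ) (Sc : Matrix ι₀ κ ℂ) {Cf : Matrix κ ι₁ ℂ} {Sf : Matrix ι₁ κ ℂ}
    (hCfSf : Cf * Sf = 1) (P : Matrix ι₁ ι₀ ℂ) (B : κ → ℂ) :
    Cf *ᵥ (trial hHc hHf Cc Sc Cf Sf P *ᵥ B) = B := by
  rw [trial, sub_mulVec, mulVec_sub, ← mulVec_mulVec, Cf_P_harmExt_mulVec, ← mulVec_mulVec, C_harmExt_mulVec hHf hCfSf]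
  abel

/-- **THE EXACT BOOKKEEPING**: `re⟨w, H_f w⟩ = re⟨Ph_cB, H_f Ph_cB⟩ − 2re⟨B, E_f(RB)⟩ − re⟨RB, E_f(RB)⟩` (outer Euler–Lagrange `H_f h_f = C_fᴴE_f`). [folklore] -/
theorem trial_quad_re (hHc : Hc.IsHermitian) (hHf : Hf.PosSemidef) (Cc : Matrix κ ι₀ ℂ) (Sc : Matrix ι₀ κ ℂ) {Cf : Matrix κ ι₁ ℂ} {Sf : Matrix ι₁ κ ℂ}
    (hCfSf : Cf * Sf = 1) (P : Matrix ι₁ ι₀ ℂ) (B : κ → ℂ) :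
    (star (trial hHc hHf.isHermitian Cc Sc Cf Sf P *ᵥ B) ⬝ᵥ (Hf *ᵥ (trial hHc hHf.isHermitian Cc Sc Cf Sf P *ᵥ B))).re
      = (star (P *ᵥ (harmExt hHc Cc Sc *ᵥ B)) ⬝ᵥ (Hf *ᵥ (P *ᵥ (harmExt hHc Cc Sc *ᵥ B)))).re
        - 2 * (star B ⬝ᵥ (shortForm hHf.isHermitian Cf Sf *ᵥ (rowDefect hHc Cc Sc Cf P *ᵥ B))).re
        - (star (rowDefect hHc Cc Sc Cf P *ᵥ B) ⬝ᵥ (shortForm hHf.isHermitian Cf Sf *ᵥ (rowDefect hHc Cc Sc Cf P *ᵥ B))).re := by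
  set u := P *ᵥ (harmExt hHc Cc Sc *ᵥ B) with hu
  set r := rowDefect hHc Cc Sc Cf P *ᵥ B with hr
  set Ef := shortForm hHf.isHermitian Cf Sf with hEf
  set h := harmExt hHf.isHermitian Cf Sf *ᵥ r with hh
  have hw : trial hHc hHf.isHermitian Cc Sc Cf Sf P *ᵥ B = u - h := by
    rw [trial, sub_mulVec, ← mulVec_mulVec, ← mulVec_mulVec]
  have hCu : Cf *ᵥ u = B + r := by rw [hu, hr]; exact Cf_P_harmExt_mulVec hHc Cc Sc Cf P B
  -- `H_f h = C_fᴴ (E_f r)`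
  have hHh : Hf *ᵥ h = Cfᴴ *ᵥ (Ef *ᵥ r) := by rw [hh, hEf]; exact H_harmExt_mulVec hHf hCfSf r
  -- the four terms
  have e1 : star h ⬝ᵥ (Hf *ᵥ u) = star (Ef *ᵥ r) ⬝ᵥ (B + r) := by
    have : star h ⬝ᵥ (Hf *ᵥ u) = star (Hf *ᵥ h) ⬝ᵥ u := by rw [conj_pairing Hf h, hHf.isHermitian.eq]
    rw [this, hHh, conj_pairing, conjTranspose_conjTranspose, hCu]
  have e2 : star u ⬝ᵥ (Hf *ᵥ h) = star (B + r) ⬝ᵥ (Ef *ᵥ r) := by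
    rw [hHh, ← conj_pairing Cf u, hCu]
  have e3 : star h ⬝ᵥ (Hf *ᵥ h) = star r ⬝ᵥ (Ef *ᵥ r) := by rw [hh, hEf, shortForm_quad]
  have hEh : Ef.IsHermitian := shortForm_isHermitian _ _ _
  have e1re : (star (Ef *ᵥ r) ⬝ᵥ (B + r)).re = (star B ⬝ᵥ (Ef *ᵥ r)).re + (star r ⬝ᵥ (Ef *ᵥ r)).re := by
    have : star (Ef *ᵥ r) ⬝ᵥ (B + r) = star (star (B + r) ⬝ᵥ (Ef *ᵥ r)) := by rw [star_dotProduct]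
    rw [this, Complex.star_def, Complex.conj_re, star_add, add_dotProduct, Complex.add_re]
  have e2re : (star (B + r) ⬝ᵥ (Ef *ᵥ r)).re = (star B ⬝ᵥ (Ef *ᵥ r)).re + (star r ⬝ᵥ (Ef *ᵥ r)).re := by
    rw [star_add, add_dotProduct, Complex.add_re]
  rw [hw, mulVec_sub, star_sub, sub_dotProduct, dotProduct_sub, dotProduct_sub, Complex.sub_re, Complex.sub_re, Complex.sub_re, e1, e2, e3,
    e1re, e2re]
  ring

/-! ## §2 The squeeze and the energy distance -/

/-- **THE UPPER BOUND FROM ONE COMPETITOR**: under (PROL) `re⟨Pu, H_f Pu⟩ ≤ re⟨u, H_c u⟩` (all `u`),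
`re⟨B, E_f B⟩ ≤ re⟨B, E_c B⟩ − 2re⟨B, E_f(RB)⟩ − re⟨RB, E_f(RB)⟩`. [folklore] -/
theorem shortForm_quad_le_trial (hHc : Hc.PosSemidef) (hHf : Hf.PosSemidef) {Cc : Matrix κ ι₀ ℂ} {Sc : Matrix ι₀ κ ℂ} {Cf : Matrix κ ι₁ ℂ}
    {Sf : Matrix ι₁ κ ℂ} (hCfSf : Cf * Sf = 1) {P : Matrix ι₁ ι₀ ℂ}
    (hprol : ∀ u : ι₀ → ℂ, (star (P *ᵥ u) ⬝ᵥ (Hf *ᵥ (P *ᵥ u))).re ≤ (star u ⬝ᵥ (Hc *ᵥ u)).re) (B : κ → ℂ) :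
    (star B ⬝ᵥ (shortForm hHf.isHermitian Cf Sf *ᵥ B)).re
      ≤ (star B ⬝ᵥ (shortForm hHc.isHermitian Cc Sc *ᵥ B)).re
        - 2 * (star B ⬝ᵥ (shortForm hHf.isHermitian Cf Sf *ᵥ (rowDefect hHc.isHermitian Cc Sc Cf P *ᵥ B))).re
        - (star (rowDefect hHc.isHermitian Cc Sc Cf P *ᵥ B) ⬝ᵥ
            (shortForm hHf.isHermitian Cf Sf *ᵥ (rowDefect hHc.isHermitian Cc Sc Cf P *ᵥ B))).re := by
  have h1 := (Complex.le_def.mp (shortForm_quad_le hHf hCfSf (Cf_trial_mulVec hHc.isHermitian hHf.isHermitian Cc Sc hCfSf P B))).1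
  rw [trial_quad_re hHc.isHermitian hHf Cc Sc hCfSf P B] at h1
  have h2 := hprol (harmExt hHc.isHermitian Cc Sc *ᵥ B)
  rw [← shortForm_quad] at h2
  linarith

/-- **THE SQUEEZE**: under (PROL) and (MONO) `(E_f − E_c).PosSemidef` (road P4's `effAction_step_mono`∕`shortForm_coarsen_le`), for every `B`:
`0 ≤ re⟨B,(E_f − E_c)B⟩ ≤ −2·re⟨B, E_f(RB)⟩` — the gap between the levels is controlled by the ROW DEFECT of the prolongated coarse minimiser. [folklore] -/
theorem squeeze (hHc : Hc.PosSemidef) (hHf : Hf.PosSemidef) {Cc : Matrix κ ι₀ ℂ} {Sc : Matrix ι₀ κ ℂ} {Cf : Matrix κ ι₁ ℂ} {Sf : Matrix ι₁ κ ℂ}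
    (hCfSf : Cf * Sf = 1) {P : Matrix ι₁ ι₀ ℂ}
    (hprol : ∀ u : ι₀ → ℂ, (star (P *ᵥ u) ⬝ᵥ (Hf *ᵥ (P *ᵥ u))).re ≤ (star u ⬝ᵥ (Hc *ᵥ u)).re)
    (hmono : (shortForm hHf.isHermitian Cf Sf - shortForm hHc.isHermitian Cc Sc).PosSemidef) (B : κ → ℂ) :
    0 ≤ (star B ⬝ᵥ ((shortForm hHf.isHermitian Cf Sf - shortForm hHc.isHermitian Cc Sc) *ᵥ B)).re
      ∧ (star B ⬝ᵥ ((shortForm hHf.isHermitian Cf Sf - shortForm hHc.isHermitian Cc Sc) *ᵥ B)).re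
          ≤ -2 * (star B ⬝ᵥ (shortForm hHf.isHermitian Cf Sf *ᵥ (rowDefect hHc.isHermitian Cc Sc Cf P *ᵥ B))).re := by
  have h0 := (Complex.nonneg_iff.mp (hmono.dotProduct_mulVec_nonneg B)).1
  refine ⟨h0, ?_⟩
  have h1 := shortForm_quad_le_trial (Cc := Cc) (Sc := Sc) hHc hHf hCfSf hprol B
  have h2 := (Complex.nonneg_iff.mp ((shortForm_posSemidef hHf Cf Sf).dotProduct_mulVec_nonneg (rowDefect hHc.isHermitian Cc Sc Cf P *ᵥ B))).1
  rw [sub_mulVec, dotProduct_sub, Complex.sub_re]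
  linarith

/-- **THE ENERGY DISTANCE OF THE TRIAL FIELD TO THE FINE MINIMISER** (Pythagoras on the fibre): under (PROL) and (MONO),
`re⟨w − h_fB, H_f(w − h_fB)⟩ ≤ −2re⟨B, E_f(RB)⟩ − re⟨RB, E_f(RB)⟩ ≤ −2re⟨B, E_f(RB)⟩` — R1's S6(i) in abstract form. [folklore] -/
theorem energy_dist_trial_le (hHc : Hc.PosSemidef) (hHf : Hf.PosSemidef) {Cc : Matrix κ ι₀ ℂ} {Sc : Matrix ι₀ κ ℂ} {Cf : Matrix κ ι₁ ℂ}
    {Sf : Matrix ι₁ κ ℂ} (hCfSf : Cf * Sf = 1) {P : Matrix ι₁ ι₀ ℂ}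
    (hprol : ∀ u : ι₀ → ℂ, (star (P *ᵥ u) ⬝ᵥ (Hf *ᵥ (P *ᵥ u))).re ≤ (star u ⬝ᵥ (Hc *ᵥ u)).re)
    (hmono : (shortForm hHf.isHermitian Cf Sf - shortForm hHc.isHermitian Cc Sc).PosSemidef) (B : κ → ℂ) :
    (star (trial hHc.isHermitian hHf.isHermitian Cc Sc Cf Sf P *ᵥ B - harmExt hHf.isHermitian Cf Sf *ᵥ B) ⬝ᵥ
        (Hf *ᵥ (trial hHc.isHermitian hHf.isHermitian Cc Sc Cf Sf P *ᵥ B - harmExt hHf.isHermitian Cf Sf *ᵥ B))).re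
      ≤ -2 * (star B ⬝ᵥ (shortForm hHf.isHermitian Cf Sf *ᵥ (rowDefect hHc.isHermitian Cc Sc Cf P *ᵥ B))).re
        - (star (rowDefect hHc.isHermitian Cc Sc Cf P *ᵥ B) ⬝ᵥ
            (shortForm hHf.isHermitian Cf Sf *ᵥ (rowDefect hHc.isHermitian Cc Sc Cf P *ᵥ B))).re := by
  set w := trial hHc.isHermitian hHf.isHermitian Cc Sc Cf Sf P *ᵥ B with hwdef
  set hB := harmExt hHf.isHermitian Cf Sf *ᵥ B with hhB
  -- Pythagoras: `⟨w, H w⟩ = ⟨hB, H hB⟩ + ⟨w − hB, H (w − hB)⟩` since `C_f (w − hB) = 0`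
  have hker : Cf *ᵥ (w - hB) = 0 := by
    rw [mulVec_sub, hwdef, Cf_trial_mulVec hHc.isHermitian hHf.isHermitian Cc Sc hCfSf P B, hhB, C_harmExt_mulVec hHf.isHermitian hCfSf, sub_self]
  have hpy := quad_harmExt_add hHf Cf Sf B hker
  have e : hB + (w - hB) = w := by abel
  rw [← hhB, e] at hpy
  have hpy_re := congrArg Complex.re hpy
  rw [Complex.add_re, ← shortForm_quad] at hpy_re
  -- `re⟨w,Hw⟩` = the bookkeeping; `re⟨hB,H hB⟩ = re⟨B,E_f B⟩ ≥ re⟨B,E_c B⟩ ≥ re⟨Ph_cB, H_f Ph_cB⟩`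
  have hbk := trial_quad_re hHc.isHermitian hHf Cc Sc hCfSf P B
  have hmo := (Complex.nonneg_iff.mp (hmono.dotProduct_mulVec_nonneg B)).1
  rw [sub_mulVec, dotProduct_sub, Complex.sub_re] at hmo
  have hpr := hprol (harmExt hHc.isHermitian Cc Sc *ᵥ B)
  rw [← shortForm_quad] at hpr
  rw [← hwdef] at hbk
  linarith

/-! ## §3 Norm form: a row defect of size `ρ` gives the rate `2‖E_f‖·ρ` -/

/-- Cauchy–Schwarz with an operator norm: `|re⟨B, E r⟩| ≤ ‖E‖·√(nsq B)·√(nsq r)`. [folklore] -/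
theorem re_pairing_le_opNorm (E : Matrix κ κ ℂ) (B r : κ → ℂ) :
    |(star B ⬝ᵥ (E *ᵥ r)).re| ≤ ‖E‖ * Real.sqrt (nsq B) * Real.sqrt (nsq r) := by
  have h1 : |(star B ⬝ᵥ (E *ᵥ r)).re| ≤ ‖star B ⬝ᵥ (E *ᵥ r)‖ := Complex.abs_re_le_norm _
  have h2 := norm_star_dotProduct_le B (E *ᵥ r)
  have h3 : Real.sqrt (nsq (E *ᵥ r)) ≤ ‖E‖ * Real.sqrt (nsq r) := by
    have h := nsq_mulVec_le E r
    calc Real.sqrt (nsq (E *ᵥ r)) ≤ Real.sqrt (‖E‖ ^ 2 * nsq r) := Real.sqrt_le_sqrt h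
      _ = ‖E‖ * Real.sqrt (nsq r) := by rw [Real.sqrt_mul (sq_nonneg _), Real.sqrt_sq (norm_nonneg _)]
  have h4 : 0 ≤ Real.sqrt (nsq B) := Real.sqrt_nonneg _
  calc |(star B ⬝ᵥ (E *ᵥ r)).re| ≤ Real.sqrt (nsq B) * Real.sqrt (nsq (E *ᵥ r)) := h1.trans h2
    _ ≤ Real.sqrt (nsq B) * (‖E‖ * Real.sqrt (nsq r)) := mul_le_mul_of_nonneg_left h3 h4
    _ = ‖E‖ * Real.sqrt (nsq B) * Real.sqrt (nsq r) := by ring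

/-- **THE RATE FROM THE ROW DEFECT**: under (PROL), (MONO), `‖E_f‖ ≤ Λ` and a row-defect bound `nsq (RB) ≤ ρ²·nsq B` (`ρ ≥ 0`):
`re⟨B,(E_f − E_c)B⟩ ≤ 2Λρ·nsq B` AND the trial field is within `2Λρ·nsq B` of the fine minimiser in squared ENERGY norm — a second-order row defect
`ρ = O(η²)` is exactly the `η²` rate of route R1 (values) and the `η` rate of its S6(i) (energy norm). [folklore] -/
theorem squeeze_nsq (hHc : Hc.PosSemidef) (hHf : Hf.PosSemidef) {Cc : Matrix κ ι₀ ℂ} {Sc : Matrix ι₀ κ ℂ} {Cf : Matrix κ ι₁ ℂ} {Sf : Matrix ι₁ κ ℂ}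
    (hCfSf : Cf * Sf = 1) {P : Matrix ι₁ ι₀ ℂ}
    (hprol : ∀ u : ι₀ → ℂ, (star (P *ᵥ u) ⬝ᵥ (Hf *ᵥ (P *ᵥ u))).re ≤ (star u ⬝ᵥ (Hc *ᵥ u)).re)
    (hmono : (shortForm hHf.isHermitian Cf Sf - shortForm hHc.isHermitian Cc Sc).PosSemidef)
    {Λ ρ : ℝ} (hΛ : ‖shortForm hHf.isHermitian Cf Sf‖ ≤ Λ) (hρ : 0 ≤ ρ)
    (hR : ∀ B : κ → ℂ, nsq (rowDefect hHc.isHermitian Cc Sc Cf P *ᵥ B) ≤ ρ ^ 2 * nsq B) (B : κ → ℂ) :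
    (star B ⬝ᵥ ((shortForm hHf.isHermitian Cf Sf - shortForm hHc.isHermitian Cc Sc) *ᵥ B)).re ≤ 2 * Λ * ρ * nsq B
      ∧ (star (trial hHc.isHermitian hHf.isHermitian Cc Sc Cf Sf P *ᵥ B - harmExt hHf.isHermitian Cf Sf *ᵥ B) ⬝ᵥ
          (Hf *ᵥ (trial hHc.isHermitian hHf.isHermitian Cc Sc Cf Sf P *ᵥ B - harmExt hHf.isHermitian Cf Sf *ᵥ B))).re ≤ 2 * Λ * ρ * nsq B := by
  set Ef := shortForm hHf.isHermitian Cf Sf with hEf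
  set r := rowDefect hHc.isHermitian Cc Sc Cf P *ᵥ B with hr
  have hcs := re_pairing_le_opNorm Ef B r
  have hsq : Real.sqrt (nsq r) ≤ ρ * Real.sqrt (nsq B) := by
    calc Real.sqrt (nsq r) ≤ Real.sqrt (ρ ^ 2 * nsq B) := Real.sqrt_le_sqrt (hR B)
      _ = ρ * Real.sqrt (nsq B) := by rw [Real.sqrt_mul (sq_nonneg _), Real.sqrt_sq hρ]
  have hE0 : 0 ≤ ‖Ef‖ := norm_nonneg _
  have hΛ0 : 0 ≤ Λ := hE0.trans hΛ
  have hB0 : 0 ≤ Real.sqrt (nsq B) := Real.sqrt_nonneg _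
  have hBB : Real.sqrt (nsq B) * Real.sqrt (nsq B) = nsq B := Real.mul_self_sqrt (nsq_nonneg B)
  have hmain : |(star B ⬝ᵥ (Ef *ᵥ r)).re| ≤ Λ * ρ * nsq B := by
    calc |(star B ⬝ᵥ (Ef *ᵥ r)).re| ≤ ‖Ef‖ * Real.sqrt (nsq B) * Real.sqrt (nsq r) := hcs
      _ ≤ Λ * Real.sqrt (nsq B) * (ρ * Real.sqrt (nsq B)) :=
          mul_le_mul (mul_le_mul_of_nonneg_right hΛ hB0) hsq (Real.sqrt_nonneg _) (mul_nonneg hΛ0 hB0)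
      _ = Λ * ρ * (Real.sqrt (nsq B) * Real.sqrt (nsq B)) := by ring
      _ = Λ * ρ * nsq B := by rw [hBB]
  have hsq2 := (squeeze hHc hHf hCfSf hprol hmono B).2
  have hed := energy_dist_trial_le hHc hHf hCfSf hprol hmono B
  have hrr : 0 ≤ (star r ⬝ᵥ (Ef *ᵥ r)).re := (Complex.nonneg_iff.mp ((shortForm_posSemidef hHf Cf Sf).dotProduct_mulVec_nonneg r)).1
  have hab := (abs_le.mp hmain).1
  constructor
  · linarith
  · rw [← hEf, ← hr] at hed; linarith

end Summit.QuantumFields.BalabanUV.Beta.GAN24.MonotoneSqueeze
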